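import Mathlib
import Literature.Probability.Process.BackwardCondExpConvergence
import Literature.MathematicalPhysics.QuantumLattice.RandomField
import HarnessLib

/-!
# Crux `GaussianLimitIsFree` (item stmt-CriticalPhenomena-2601), line `registered` (birth v8):
# stub `stub_reverseMartingale_tendsto` — Lévy's downward theorem, existence of the a.e. limit

THEOREM-ONLY helper file for the sorry-free glue `stub_markovInheritance` of the skeleton
`Cruxes/GaussianLimitIsFree/Lines/birth.lean` (v8): along `εₙ = 1/(n+1)` the collar Markov
identities are a.e. equalities between two *reverse* martingales `μ[F | ℱ n]` (antitone `ℱ`),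
and the glue needs the existence of an a.e. limit `G` of `μ[F | ℱ n]` which is measurable for
`⨅ n, ℱ n` and keeps the bound `C` (this file), plus its identification with `μ[F | ⨅ n, ℱ n]`
(the neighbour stub).  Mathlib has only the upward theorem (`Integrable.tendsto_ae_condExp`).

Proof (general finite measure space `Ω`, bounded `f`; D. Williams, *Probability with
Martingales*, §14.4, here through Doob's maximal inequality instead of upcrossings):

1. (`measure_exists_abs_condExp_sub_ge_le`) for `N ≤ M` the time-reversed finite sequence
   `k ↦ μ[f | ℱ (M - k)] - μ[f | ℱ M]` is a martingale for the increasing filtration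
   `k ↦ ℱ (M - k)` (tower property), so its absolute value is a non-negative submartingale and
   Doob's maximal inequality (`MeasureTheory.maximal_ineq`) gives
   `ε · μ {∃ k ∈ [N, M], ε ≤ |μ[f|ℱ k] - μ[f|ℱ M]|} ≤ ∫ |μ[f|ℱ N] - μ[f|ℱ M]|`;
2. (`integral_abs_condExp_sub_le`) by orthogonality of reverse-martingale increments
   (`Literature.Probability.Process.integral_sq_condExp_sub_condExp`) and Cauchy–Schwarz,
   `∫ |μ[f|ℱ N] - μ[f|ℱ M]| ≤ √(a N - a M) · √(μ univ)` with `a n = ∫ μ[f|ℱ n]²` antitone and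
   bounded below, hence convergent;
3. (`ae_exists_forall_abs_condExp_sub_lt`) so `μ {∃ n ≥ N, η ≤ |μ[f|ℱ n] - μ[f|ℱ N]|} → 0` as
   `N → ∞` for every `η > 0`, i.e. a.e. the sequence `n ↦ μ[f|ℱ n] x` is Cauchy
   (`ae_cauchySeq_condExp`), hence convergent;
4. (`exists_measurable_iInf_tendsto_condExp`) the `limsup` of the sequence is `ℱ n`-measurable
   for every `n` (shift invariance of `limsup`, antitonicity), hence `(⨅ n, ℱ n)`-measurable, and
   its truncation to `[-C, C]` is still an a.e. limit since `|μ[f|ℱ n]| ≤ C` a.e.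

The registered statement `stub_reverseMartingale_tendsto` is the specialisation to a probability
law on `𝒮'(ℝ³) = FieldConfig (EuclideanSpace ℝ (Fin 3))`.
-/

noncomputable section

namespace Summit.CriticalPhenomena.Ising3DConformalLimit.Cruxes.GaussianLimitIsFree.Birth

open MeasureTheory Filter
open scoped Topology ENNReal NNReal

namespace ReverseMartingaleTendsto

variable {Ω : Type*} {m0 : MeasurableSpace Ω}

/-! ### Cauchy–Schwarz and the `L¹` size of reverse-martingale increments -/

/-- Cauchy–Schwarz on a finite measure space for a bounded function:
`∫ |g| ≤ √(∫ g²) · √(μ univ)`. [folklore] -/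
theorem integral_abs_le_sqrt_mul_sqrt (μ : Measure Ω) [IsFiniteMeasure μ] {g : Ω → ℝ} {R : ℝ}
    (hg : AEStronglyMeasurable g μ) (hgR : ∀ᵐ x ∂μ, |g x| ≤ R) :
    ∫ x, |g x| ∂μ ≤ Real.sqrt (∫ x, g x ^ 2 ∂μ) * Real.sqrt (μ.real Set.univ) := by
  have hga : MemLp (fun x => |g x|) (ENNReal.ofReal 2) μ :=
    MemLp.of_bound (continuous_abs.comp_aestronglyMeasurable hg) R
      (hgR.mono fun x hx => by rwa [Real.norm_eq_abs, abs_abs])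
  have h1 : MemLp (fun _ : Ω => (1 : ℝ)) (ENNReal.ofReal 2) μ := memLp_const 1
  have h := integral_mul_le_Lp_mul_Lq_of_nonneg Real.HolderConjugate.two_two
    (Eventually.of_forall fun x => abs_nonneg (g x)) (Eventually.of_forall fun _ => zero_le_one)
    hga h1
  simp only [mul_one, one_pow, integral_const, smul_eq_mul, Real.rpow_two, sq_abs] at h
  rw [Real.sqrt_eq_rpow, Real.sqrt_eq_rpow]
  exact h

/-- For an antitone sequence `ℱ` of sub-σ-algebras, bounded `f` and `N ≤ M`:
`∫ |μ[f|ℱ N] - μ[f|ℱ M]| ≤ √(∫ μ[f|ℱ N]² - ∫ μ[f|ℱ M]²) · √(μ univ)` (orthogonality of the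
increments of the reverse martingale `μ[f|ℱ n]` and Cauchy–Schwarz). [folklore] -/
theorem integral_abs_condExp_sub_le (μ : Measure Ω) [IsFiniteMeasure μ]
    {ℱ : ℕ → MeasurableSpace Ω} (hanti : Antitone ℱ) (hle : ∀ n, ℱ n ≤ m0) {f : Ω → ℝ} {C : ℝ}
    (hfC : ∀ᵐ x ∂μ, |f x| ≤ C) {N M : ℕ} (hNM : N ≤ M) :
    ∫ x, |(μ[f|ℱ N]) x - (μ[f|ℱ M]) x| ∂μ ≤
      Real.sqrt (∫ x, (μ[f|ℱ N]) x ^ 2 ∂μ - ∫ x, (μ[f|ℱ M]) x ^ 2 ∂μ) *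
        Real.sqrt (μ.real Set.univ) := by
  rw [← Literature.Probability.Process.integral_sq_condExp_sub_condExp (μ := μ) (hanti hNM)
    (hle N) hfC]
  refine integral_abs_le_sqrt_mul_sqrt μ (R := C + C) ?_ ?_
  · exact ((stronglyMeasurable_condExp.mono (hle N)).sub
      (stronglyMeasurable_condExp.mono (hle M))).aestronglyMeasurable
  · filter_upwards [ae_bdd_abs_condExp_of_ae_bdd_abs (μ := μ) (m := ℱ N) hfC,
      ae_bdd_abs_condExp_of_ae_bdd_abs (μ := μ) (m := ℱ M) hfC] with x h1 h2
    exact (abs_sub _ _).trans (add_le_add h1 h2)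

/-! ### The reversed martingale and Doob's maximal inequality -/

/-- **Maximal inequality for a reverse martingale on a finite horizon.**  For an antitone
sequence `ℱ` of sub-σ-algebras, `N ≤ M` and `ε > 0`,
`μ {∃ k ∈ [N, M], ε ≤ |μ[f|ℱ k] - μ[f|ℱ M]|} ≤ (∫ |μ[f|ℱ N] - μ[f|ℱ M]|) / ε`:
the time-reversed sequence `k ↦ μ[f|ℱ (M - k)] - μ[f|ℱ M]` is a martingale for the filtration
`k ↦ ℱ (M - k)`, its absolute value a non-negative submartingale, and Doob's maximal inequality
(`MeasureTheory.maximal_ineq`) applies on `{0, …, M - N}`. [folklore] -/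
theorem measure_exists_abs_condExp_sub_ge_le (μ : Measure Ω) [IsFiniteMeasure μ]
    {ℱ : ℕ → MeasurableSpace Ω} (hanti : Antitone ℱ) (hle : ∀ n, ℱ n ≤ m0) (f : Ω → ℝ)
    {N M : ℕ} (hNM : N ≤ M) {ε : ℝ} (hε : 0 < ε) :
    μ {x | ∃ k, N ≤ k ∧ k ≤ M ∧ ε ≤ |(μ[f|ℱ k]) x - (μ[f|ℱ M]) x|} ≤
      ENNReal.ofReal ((∫ x, |(μ[f|ℱ N]) x - (μ[f|ℱ M]) x| ∂μ) / ε) := by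
  -- the reversed filtration and the reversed martingale
  let 𝒢 : Filtration ℕ m0 :=
    ⟨fun k => ℱ (M - k), fun _ _ hkl => hanti (Nat.sub_le_sub_left hkl M), fun k => hle (M - k)⟩
  let Y : ℕ → Ω → ℝ := fun k x => (μ[f|ℱ (M - k)]) x - (μ[f|ℱ M]) x
  have hsmM : ∀ k, StronglyMeasurable[ℱ (M - k)] (μ[f|ℱ M]) := fun k =>
    stronglyMeasurable_condExp.mono (hanti (Nat.sub_le M k))
  have hYm : Martingale Y 𝒢 μ := by
    refine ⟨fun k => stronglyMeasurable_condExp.sub (hsmM k), fun k l hkl => ?_⟩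
    have h1 : μ[μ[f|ℱ (M - l)]|ℱ (M - k)] =ᵐ[μ] μ[f|ℱ (M - k)] :=
      condExp_condExp_of_le (hanti (Nat.sub_le_sub_left hkl M)) (hle (M - l))
    have h2 : μ[μ[f|ℱ M]|ℱ (M - k)] = μ[f|ℱ M] :=
      condExp_of_stronglyMeasurable (hle (M - k)) (hsmM k) integrable_condExp
    have h3 : μ[(μ[f|ℱ (M - l)] - μ[f|ℱ M])|ℱ (M - k)] =ᵐ[μ]
        μ[μ[f|ℱ (M - l)]|ℱ (M - k)] - μ[μ[f|ℱ M]|ℱ (M - k)] :=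
      condExp_sub integrable_condExp integrable_condExp _
    filter_upwards [h1, h3] with x hx1 hx3
    change (μ[(μ[f|ℱ (M - l)] - μ[f|ℱ M])|ℱ (M - k)]) x =
      (μ[f|ℱ (M - k)]) x - (μ[f|ℱ M]) x
    rw [hx3, Pi.sub_apply, hx1, h2]
  -- its absolute value is a non-negative submartingale
  have hZ : Submartingale (Y ⊔ -Y) 𝒢 μ := hYm.submartingale.sup hYm.neg.submartingale
  have hZpt : ∀ k x, (Y ⊔ -Y) k x = |(μ[f|ℱ (M - k)]) x - (μ[f|ℱ M]) x| := fun k x => rfl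
  have hZnn' : ∀ k x, 0 ≤ (Y ⊔ -Y) k x := fun k x => by rw [hZpt]; exact abs_nonneg _
  have hZnn : 0 ≤ Y ⊔ -Y := fun k x => hZnn' k x
  -- Doob's maximal inequality on the horizon `M - N`
  have hmax := maximal_ineq hZ hZnn (ε := ε.toNNReal) (M - N)
  have hST : {x | ∃ k, N ≤ k ∧ k ≤ M ∧ ε ≤ |(μ[f|ℱ k]) x - (μ[f|ℱ M]) x|} ⊆
      {x | ((ε.toNNReal : ℝ≥0) : ℝ) ≤ (Finset.range (M - N + 1)).sup'
        Finset.nonempty_range_add_one fun k => (Y ⊔ -Y) k x} := by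
    rintro x ⟨k, hNk, hkM, hk⟩
    simp only [Set.mem_setOf_eq, Real.coe_toNNReal _ hε.le]
    refine Finset.le_sup'_of_le _ (b := M - k) (by simp only [Finset.mem_range]; omega) ?_
    rw [hZpt, Nat.sub_sub_self hkM]
    exact hk
  have hI : ∫ x in {x | ((ε.toNNReal : ℝ≥0) : ℝ) ≤ (Finset.range (M - N + 1)).sup'
        Finset.nonempty_range_add_one fun k => (Y ⊔ -Y) k x}, (Y ⊔ -Y) (M - N) x ∂μ ≤
      ∫ x, |(μ[f|ℱ N]) x - (μ[f|ℱ M]) x| ∂μ := by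
    refine (setIntegral_le_integral (hZ.integrable _)
      (Eventually.of_forall (hZnn' (M - N)))).trans_eq ?_
    refine integral_congr_ae (Eventually.of_forall fun x => ?_)
    rw [hZpt, Nat.sub_sub_self hNM]
  have hε' : ENNReal.ofReal ε ≠ 0 := (ENNReal.ofReal_pos.2 hε).ne'
  rw [ENNReal.ofReal_div_of_pos hε,
    ENNReal.le_div_iff_mul_le (Or.inl hε') (Or.inl ENNReal.ofReal_ne_top), mul_comm]
  calc ENNReal.ofReal ε * μ {x | ∃ k, N ≤ k ∧ k ≤ M ∧ ε ≤ |(μ[f|ℱ k]) x - (μ[f|ℱ M]) x|}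
      ≤ ENNReal.ofReal ε * μ {x | ((ε.toNNReal : ℝ≥0) : ℝ) ≤ (Finset.range (M - N + 1)).sup'
          Finset.nonempty_range_add_one fun k => (Y ⊔ -Y) k x} := by gcongr
    _ ≤ _ := hmax
    _ ≤ ENNReal.ofReal (∫ x, |(μ[f|ℱ N]) x - (μ[f|ℱ M]) x| ∂μ) := ENNReal.ofReal_le_ofReal hI

/-! ### Almost sure Cauchy property -/

/-- For an antitone sequence `ℱ` of sub-σ-algebras of a finite measure space, bounded `f` and
`η > 0`: almost surely there is `N` with `|μ[f|ℱ n] - μ[f|ℱ N]| < η` for all `n ≥ N`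
(maximal inequality + `L²`-convergence of the reverse martingale). [folklore] -/
theorem ae_exists_forall_abs_condExp_sub_lt (μ : Measure Ω) [IsFiniteMeasure μ]
    {ℱ : ℕ → MeasurableSpace Ω} (hanti : Antitone ℱ) (hle : ∀ n, ℱ n ≤ m0) {f : Ω → ℝ} {C : ℝ}
    (hfC : ∀ᵐ x ∂μ, |f x| ≤ C) {η : ℝ} (hη : 0 < η) :
    ∀ᵐ x ∂μ, ∃ N, ∀ n, N ≤ n → |(μ[f|ℱ n]) x - (μ[f|ℱ N]) x| < η := by
  -- the `L²` norms `a n = ∫ μ[f|ℱ n]²`: antitone, bounded below, convergent to their infimum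
  set a : ℕ → ℝ := fun n => ∫ x, (μ[f|ℱ n]) x ^ 2 ∂μ with ha
  have hanti_a : Antitone a := fun n k hnk =>
    Literature.Probability.Process.integral_sq_condExp_mono (hanti hnk) (hle n) hfC
  have hbdd : BddBelow (Set.range a) := ⟨0, by
    rintro _ ⟨n, rfl⟩
    exact integral_nonneg fun x => sq_nonneg _⟩
  have hLle : ∀ n, ⨅ k, a k ≤ a n := fun n => ciInf_le hbdd n
  have haL : Tendsto a atTop (𝓝 (⨅ k, a k)) := tendsto_atTop_ciInf hanti_a hbdd
  -- the bound `b N` and its limit `0`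
  set B : ℕ → ℝ := fun N => Real.sqrt (a N - ⨅ k, a k) * Real.sqrt (μ.real Set.univ) with hB
  set b : ℕ → ℝ := fun N => B N / (η / 2) with hb
  have hb0 : Tendsto b atTop (𝓝 0) := by
    have h1 : Tendsto (fun N => a N - ⨅ k, a k) atTop (𝓝 0) := by
      rw [← sub_self (⨅ k, a k)]
      exact haL.sub_const _
    have h2 : Tendsto (fun N => Real.sqrt (a N - ⨅ k, a k)) atTop (𝓝 0) := by
      have h := (Real.continuous_sqrt.tendsto 0).comp h1
      rwa [Real.sqrt_zero] at h
    have h3 := (h2.mul_const (Real.sqrt (μ.real Set.univ))).div_const (η / 2)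
    rwa [zero_mul, zero_div] at h3
  -- finite horizon: `μ {∃ n ∈ [N, N + M], η ≤ |μ[f|ℱ n] - μ[f|ℱ N]|} ≤ b N`
  have hfin : ∀ N M : ℕ,
      μ {x | ∃ n, N ≤ n ∧ n ≤ N + M ∧ η ≤ |(μ[f|ℱ n]) x - (μ[f|ℱ N]) x|} ≤
        ENNReal.ofReal (b N) := by
    intro N M
    have hNM : N ≤ N + M := Nat.le_add_right N M
    have hsub : {x | ∃ n, N ≤ n ∧ n ≤ N + M ∧ η ≤ |(μ[f|ℱ n]) x - (μ[f|ℱ N]) x|} ⊆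
        {x | ∃ k, N ≤ k ∧ k ≤ N + M ∧ η / 2 ≤ |(μ[f|ℱ k]) x - (μ[f|ℱ (N + M)]) x|} := by
      rintro x ⟨n, hNn, hnM, hηn⟩
      by_cases hk : η / 2 ≤ |(μ[f|ℱ n]) x - (μ[f|ℱ (N + M)]) x|
      · exact ⟨n, hNn, hnM, hk⟩
      · refine ⟨N, le_rfl, hNM, ?_⟩
        have htri : |(μ[f|ℱ n]) x - (μ[f|ℱ N]) x| ≤
            |(μ[f|ℱ n]) x - (μ[f|ℱ (N + M)]) x| + |(μ[f|ℱ N]) x - (μ[f|ℱ (N + M)]) x| := by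
          rw [abs_sub_comm ((μ[f|ℱ N]) x) ((μ[f|ℱ (N + M)]) x)]
          exact abs_sub_le _ _ _
        push Not at hk
        linarith
    calc μ {x | ∃ n, N ≤ n ∧ n ≤ N + M ∧ η ≤ |(μ[f|ℱ n]) x - (μ[f|ℱ N]) x|}
        ≤ μ {x | ∃ k, N ≤ k ∧ k ≤ N + M ∧ η / 2 ≤ |(μ[f|ℱ k]) x - (μ[f|ℱ (N + M)]) x|} :=
          measure_mono hsub
      _ ≤ ENNReal.ofReal ((∫ x, |(μ[f|ℱ N]) x - (μ[f|ℱ (N + M)]) x| ∂μ) / (η / 2)) :=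
          measure_exists_abs_condExp_sub_ge_le μ hanti hle f hNM (half_pos hη)
      _ ≤ ENNReal.ofReal (b N) := by
          refine ENNReal.ofReal_le_ofReal (div_le_div_of_nonneg_right ?_ (half_pos hη).le)
          refine (integral_abs_condExp_sub_le μ hanti hle hfC hNM).trans ?_
          change Real.sqrt (a N - a (N + M)) * Real.sqrt (μ.real Set.univ) ≤
            Real.sqrt (a N - ⨅ k, a k) * Real.sqrt (μ.real Set.univ)
          gcongr
          exact hLle (N + M)
  -- infinite horizon, by continuity from below
  have hinf : ∀ N, μ {x | ∃ n, N ≤ n ∧ η ≤ |(μ[f|ℱ n]) x - (μ[f|ℱ N]) x|} ≤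
      ENNReal.ofReal (b N) := by
    intro N
    have hU : {x | ∃ n, N ≤ n ∧ η ≤ |(μ[f|ℱ n]) x - (μ[f|ℱ N]) x|} =
        ⋃ M : ℕ, {x | ∃ n, N ≤ n ∧ n ≤ N + M ∧ η ≤ |(μ[f|ℱ n]) x - (μ[f|ℱ N]) x|} := by
      ext x
      simp only [Set.mem_setOf_eq, Set.mem_iUnion]
      constructor
      · rintro ⟨n, hNn, hn⟩
        exact ⟨n - N, n, hNn, by omega, hn⟩
      · rintro ⟨M, n, hNn, -, hn⟩
        exact ⟨n, hNn, hn⟩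
    have hmono : Monotone fun M : ℕ =>
        {x | ∃ n, N ≤ n ∧ n ≤ N + M ∧ η ≤ |(μ[f|ℱ n]) x - (μ[f|ℱ N]) x|} := by
      intro M M' hMM' x
      rintro ⟨n, hNn, hnM, hn⟩
      exact ⟨n, hNn, hnM.trans (by omega), hn⟩
    rw [hU, hmono.measure_iUnion]
    exact iSup_le fun M => hfin N M
  -- the intersection over `N` is a null set
  have hzero : μ (⋂ N, {x | ∃ n, N ≤ n ∧ η ≤ |(μ[f|ℱ n]) x - (μ[f|ℱ N]) x|}) = 0 := by
    have hlim : Tendsto (fun N => ENNReal.ofReal (b N)) atTop (𝓝 0) := by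
      have h := ENNReal.tendsto_ofReal hb0
      rwa [ENNReal.ofReal_zero] at h
    exact le_antisymm (ge_of_tendsto' hlim fun N =>
      (measure_mono (Set.iInter_subset _ N)).trans (hinf N)) bot_le
  rw [ae_iff]
  refine measure_mono_null (fun x hx => ?_) hzero
  simp only [Set.mem_setOf_eq, not_exists, not_forall, not_lt, exists_prop] at hx
  simp only [Set.mem_iInter, Set.mem_setOf_eq]
  intro N
  obtain ⟨n, hNn, hn⟩ := hx N
  exact ⟨n, hNn, hn⟩

/-- **Reverse martingales of a bounded function are a.e. Cauchy**: for an antitone sequence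
`ℱ` of sub-σ-algebras of a finite measure space and bounded `f`, almost surely the sequence
`n ↦ μ[f|ℱ n] x` is a Cauchy sequence. [folklore] -/
theorem ae_cauchySeq_condExp (μ : Measure Ω) [IsFiniteMeasure μ] {ℱ : ℕ → MeasurableSpace Ω}
    (hanti : Antitone ℱ) (hle : ∀ n, ℱ n ≤ m0) {f : Ω → ℝ} {C : ℝ}
    (hfC : ∀ᵐ x ∂μ, |f x| ≤ C) :
    ∀ᵐ x ∂μ, CauchySeq fun n => (μ[f|ℱ n]) x := by
  have hall : ∀ᵐ x ∂μ, ∀ k : ℕ, ∃ N, ∀ n, N ≤ n →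
      |(μ[f|ℱ n]) x - (μ[f|ℱ N]) x| < 1 / ((k : ℝ) + 1) :=
    ae_all_iff.2 fun k =>
      ae_exists_forall_abs_condExp_sub_lt μ hanti hle hfC Nat.one_div_pos_of_nat
  filter_upwards [hall] with x hx
  refine Metric.cauchySeq_iff'.2 fun ε hε => ?_
  obtain ⟨k, hk⟩ := exists_nat_one_div_lt hε
  obtain ⟨N, hN⟩ := hx k
  exact ⟨N, fun n hn => by rw [Real.dist_eq]; exact (hN n hn).trans hk⟩

/-- **Lévy's downward theorem, existence part.**  For an antitone sequence `ℱ` of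
sub-σ-algebras of a finite measure space and `f` with `|f| ≤ C` a.e. (`0 ≤ C`), there is a
`(⨅ n, ℱ n)`-measurable `G` with `|G| ≤ C` everywhere such that `μ[f|ℱ n] → G` almost
everywhere (Williams, *Probability with Martingales*, Thm. 14.4, existence half). [folklore] -/
theorem exists_measurable_iInf_tendsto_condExp (μ : Measure Ω) [IsFiniteMeasure μ]
    {ℱ : ℕ → MeasurableSpace Ω} (hanti : Antitone ℱ) (hle : ∀ n, ℱ n ≤ m0) {f : Ω → ℝ} {C : ℝ}
    (hC : 0 ≤ C) (hfC : ∀ᵐ x ∂μ, |f x| ≤ C) :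
    ∃ G : Ω → ℝ, Measurable[⨅ n, ℱ n] G ∧ (∀ x, |G x| ≤ C) ∧
      ∀ᵐ x ∂μ, Tendsto (fun n => (μ[f|ℱ n]) x) atTop (𝓝 (G x)) := by
  set G₀ : Ω → ℝ := fun x => limsup (fun n => (μ[f|ℱ n]) x) atTop with hG₀
  have hG₀t : ∀ᵐ x ∂μ, Tendsto (fun n => (μ[f|ℱ n]) x) atTop (𝓝 (G₀ x)) := by
    filter_upwards [ae_cauchySeq_condExp μ hanti hle hfC] with x hx
    obtain ⟨l, hl⟩ := cauchySeq_tendsto_of_complete hx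
    have hGl : G₀ x = l := hl.limsup_eq
    rw [hGl]
    exact hl
  have hG₀n : ∀ n, Measurable[ℱ n] G₀ := by
    intro n
    have hshift : G₀ = fun x => limsup (fun j => (μ[f|ℱ (j + n)]) x) atTop := by
      funext x
      exact (Filter.limsup_nat_add (fun j => (μ[f|ℱ j]) x) n).symm
    rw [hshift]
    refine Measurable.limsup fun j => ?_
    exact (stronglyMeasurable_condExp (m := ℱ (j + n)) (μ := μ) (f := f)).measurable.mono
      (hanti (Nat.le_add_left n j)) le_rfl
  have hG₀m : Measurable[⨅ n, ℱ n] G₀ :=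
    measurable_iff_comap_le.2 (le_iInf fun n => measurable_iff_comap_le.1 (hG₀n n))
  refine ⟨fun x => max (-C) (min C (G₀ x)), measurable_const.max (measurable_const.min hG₀m),
    fun x => ?_, ?_⟩
  · rw [abs_le]
    exact ⟨le_max_left _ _, max_le (by linarith) (min_le_left _ _)⟩
  · have hbd : ∀ᵐ x ∂μ, ∀ n, |(μ[f|ℱ n]) x| ≤ C :=
      ae_all_iff.2 fun n => ae_bdd_abs_condExp_of_ae_bdd_abs hfC
    filter_upwards [hG₀t, hbd] with x hx hxC
    have hGC : |G₀ x| ≤ C :=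
      le_of_tendsto ((continuous_abs.tendsto _).comp hx) (Eventually.of_forall hxC)
    rw [abs_le] at hGC
    rwa [min_eq_right hGC.2, max_eq_right hGC.1]

end ReverseMartingaleTendsto

/-! ### The registered stub -/

/-- **Stub 2b (Lévy's downward theorem on `𝒮'(ℝ³)`, existence of the limit).**  For a
probability law `μ` on `𝒮'(ℝ³)`, an antitone sequence `ℱ n` of sub-σ-algebras of the Borel
σ-algebra and a bounded measurable `F` (`|F| ≤ C`), there is a `(⨅ n, ℱ n)`-measurable `G` with
`|G| ≤ C` such that `μ[F | ℱ n] → G` a.e. (reverse-martingale convergence; Williams,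
*Probability with Martingales*, Thm. 14.4; here via Doob's maximal inequality and the
`L²`-convergence of reverse martingales, `ReverseMartingaleTendsto.*`). [folklore] -/
theorem stub_reverseMartingale_tendsto :
    ∀ (μ : MeasureTheory.Measure (Literature.MathematicalPhysics.QuantumLattice.FieldConfig (EuclideanSpace ℝ (Fin 3))))
      [MeasureTheory.IsProbabilityMeasure μ]
      (ℱ : ℕ → MeasurableSpace (Literature.MathematicalPhysics.QuantumLattice.FieldConfig (EuclideanSpace ℝ (Fin 3)))),
      Antitone ℱ →
      (∀ n, ℱ n ≤ Literature.MathematicalPhysics.QuantumLattice.FieldConfig.instMeasurableSpace) →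
      ∀ (F : Literature.MathematicalPhysics.QuantumLattice.FieldConfig (EuclideanSpace ℝ (Fin 3)) → ℝ) (C : ℝ),
        Measurable F → (∀ ω, |F ω| ≤ C) →
        ∃ G : Literature.MathematicalPhysics.QuantumLattice.FieldConfig (EuclideanSpace ℝ (Fin 3)) → ℝ,
          Measurable[⨅ n, ℱ n] G ∧ (∀ ω, |G ω| ≤ C) ∧
          ∀ᵐ ω ∂μ, Filter.Tendsto (fun n => MeasureTheory.condExp (ℱ n) μ F ω) Filter.atTop (nhds (G ω)) := by
  intro μ _ ℱ hanti hle F C _ hFb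
  exact ReverseMartingaleTendsto.exists_measurable_iInf_tendsto_condExp μ hanti hle
    ((abs_nonneg _).trans (hFb 0)) (Filter.Eventually.of_forall hFb)

end Summit.CriticalPhenomena.Ising3DConformalLimit.Cruxes.GaussianLimitIsFree.Birth
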